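import Summits.ValiantsHypothesis.ValiantsHypothesis.Theorems.LacunarySymmetroidMatrixDescartesVLawCoreSignedEntries

/-!
# `MatrixDescartes` (stmt-ValiantsHypothesis-18050), line `Lift` — the SIGNED closed window, part 2:
# positivity (`VLawCoreSigned.core_pos₅`)

HONEST FRAMING.  Cell `pub-symmetroid`, seat `val-sym-mdr-p2` (gen 3); helper `--supports` the crux
`Theses.LacunarySymmetroid.MatrixDescartes`, NO closure claim.  Part 1 = `…VLawCoreSignedEntries.lean`; consumed by
`…FanLawFour.lean`.  Nothing here bears on `stub_twoSided` in general, the crux in its window, `DoorA26`/`DoorA34`, or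
`VP ≠ VNP`.

`core_pos₅`: H-form `H(u) = J + (u^a)⁻¹ P + ∑ u^{b l} Q l + ∑ (u^{c m})⁻¹ R m + ∑ u^a B p + ∑ ((u^a)^2)⁻¹ E r
+ ∑ (u^{cn o})⁻¹ S o` with `J` AND THE FACTORING LETTER `P` merely symmetric, `Q l, R m, B p, E r ⪰ 0` in the closed
kernel window (`0 < b l < a`, `a < c m < 2a`, gap `a`, gap `2a`) and `S o ⪯ 0` in the NEGATIVE window `0 < cn o < a`
(same side as `P`, closer to the pivot).  Kernel vectors `v j` at pairwise distinct nodes `u j > 0`, linearly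
independent, a target `s > 0` off the nodes towards which every node's Rayleigh slope points, and ONE definite
companion (`Q l`, `R m`, `B p`, `E r ≻ 0` or `S o ≺ 0`) ⇒ the quadratic form of `H(s)` is positive at every nonzero
combination of the `v j`.  At `n = 1` the hypotheses are exactly a Descartes pattern `(+)*(?)(−)*(?)(+)*` with the two
free signs at the factoring exponent and at the pivot.  [folklore] Löwner/Bernstein kernel positivity.
-/

-- layout Summits/ValiantsHypothesis/ValiantsHypothesis forces the duplicated namespace component
set_option linter.dupNamespace false

namespace Summit.ValiantsHypothesis.ValiantsHypothesis.Theorems.LacunarySymmetroidMatrixDescartes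

open MeasureTheory Set Filter Topology Matrix Finset
open scoped BigOperators
open VLawNormalForm VLawCore VLawCoreTwo VLawCoreBoundary VLawKernelThree VLawCoreSignedEntries

namespace VLawCoreSigned

variable {ι : Type*} [Fintype ι] {κ μ ν ξ η : Type*} [Fintype κ] [Fintype μ] [Fintype ν] [Fintype ξ] [Fintype η]

/-- **STAR CORE LEMMA, signed closed window.**  See the module docstring. [folklore] -/
theorem core_pos₅ [DecidableEq ι] (a : ℕ) (ha : 0 < a) (b n : κ → ℕ) (hnb : ∀ l, n l + b l + 1 = a)
    (hb : ∀ l, 0 < b l) (c n' b' : μ → ℕ) (hnb' : ∀ m, n' m + b' m + 1 = a) (hb' : ∀ m, 0 < b' m)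
    (hc : ∀ m, c m + b' m = 2 * a) (cn nn bn : η → ℕ) (hnbn : ∀ o, nn o + bn o + 1 = a) (hbn : ∀ o, 0 < bn o)
    (hcn : ∀ o, cn o + bn o = a)
    (J P : Matrix ι ι ℝ) (Q : κ → Matrix ι ι ℝ) (R : μ → Matrix ι ι ℝ) (B : ν → Matrix ι ι ℝ)
    (E : ξ → Matrix ι ι ℝ) (S : η → Matrix ι ι ℝ) (hJ : J.IsSymm) (hP : P.IsSymm)
    (hQ : ∀ l, (Q l).PosSemidef) (hR : ∀ m, (R m).PosSemidef) (hB : ∀ p, (B p).PosSemidef)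
    (hE : ∀ r, (E r).PosSemidef) (hS : ∀ o, (-S o).PosSemidef)
    {k : ℕ} (u : Fin k → ℝ) (hu : ∀ j, 0 < u j) (hinj : Function.Injective u) (v : Fin k → ι → ℝ)
    (hli : LinearIndependent ℝ v)
    (hker : ∀ j, (J + ((u j) ^ a)⁻¹ • P + ∑ l, (u j) ^ (b l) • Q l + ∑ m, ((u j) ^ (c m))⁻¹ • R m
      + ∑ p, (u j) ^ a • B p + ∑ r, (((u j) ^ a) ^ 2)⁻¹ • E r + ∑ o, ((u j) ^ (cn o))⁻¹ • S o) *ᵥ v j = 0)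
    (s : ℝ) (hs : 0 < s) (hsu : ∀ j, s ≠ u j)
    (hstar : ∀ j, 0 ≤ (s - u j) * (-((a : ℝ) * ((u j) ^ a)⁻¹ * (v j ⬝ᵥ (P *ᵥ v j)))
        + ∑ l, (b l : ℝ) * (u j) ^ (b l) * (v j ⬝ᵥ (Q l *ᵥ v j))
        - ∑ m, (c m : ℝ) * ((u j) ^ (c m))⁻¹ * (v j ⬝ᵥ (R m *ᵥ v j))
        + ∑ p, (a : ℝ) * (u j) ^ a * (v j ⬝ᵥ (B p *ᵥ v j))
        - ∑ r, (2 * a : ℝ) * (((u j) ^ a) ^ 2)⁻¹ * (v j ⬝ᵥ (E r *ᵥ v j))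
        - ∑ o, (cn o : ℝ) * ((u j) ^ (cn o))⁻¹ * (v j ⬝ᵥ (S o *ᵥ v j))))
    (hPD : (∃ l, (Q l).PosDef) ∨ (∃ m, (R m).PosDef) ∨ (∃ p, (B p).PosDef) ∨ (∃ r, (E r).PosDef)
      ∨ (∃ o, (-S o).PosDef))
    (cc : Fin k → ℝ) (hcc : cc ≠ 0) :
    0 < (∑ j, cc j • v j) ⬝ᵥ
      ((J + (s ^ a)⁻¹ • P + ∑ l, s ^ (b l) • Q l + ∑ m, (s ^ (c m))⁻¹ • R m
        + ∑ p, s ^ a • B p + ∑ r, ((s ^ a) ^ 2)⁻¹ • E r + ∑ o, (s ^ (cn o))⁻¹ • S o) *ᵥ ∑ j, cc j • v j) := by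
  classical
  have hna : ∀ l, n l + 2 ≤ a := fun l => by have := hnb l; have := hb l; omega
  have hna' : ∀ m, n' m + 2 ≤ a := fun m => by have := hnb' m; have := hb' m; omega
  have hnan : ∀ o, nn o + 2 ≤ a := fun o => by have := hnbn o; have := hbn o; omega
  have hQs : ∀ l, (Q l).IsSymm := fun l => Matrix.isHermitian_iff_isSymm.1 (hQ l).1
  have hRs : ∀ m, (R m).IsSymm := fun m => Matrix.isHermitian_iff_isSymm.1 (hR m).1
  have hBs : ∀ p, (B p).IsSymm := fun p => Matrix.isHermitian_iff_isSymm.1 (hB p).1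
  have hEs : ∀ r, (E r).IsSymm := fun r => Matrix.isHermitian_iff_isSymm.1 (hE r).1
  have hSs : ∀ o, (S o).IsSymm := fun o => by
    have h := (Matrix.isHermitian_iff_isSymm.1 (hS o).1).neg
    simpa using h
  have hw : ∀ j, 0 < ((u j) ^ a)⁻¹ := fun j => inv_pos.2 (pow_pos (hu j) a)
  have ht : 0 < (s ^ a)⁻¹ := inv_pos.2 (pow_pos hs a)
  have hC : ∀ l, 0 < ∫ ρ in Ioi (0:ℝ), ρ ^ (n l) / (1 + ρ ^ a) :=
    fun l => VLawStieltjes.stieltjesConst_pos (hna l)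
  have hC' : ∀ m, 0 < ∫ ρ in Ioi (0:ℝ), ρ ^ (n' m) / (1 + ρ ^ a) :=
    fun m => VLawStieltjes.stieltjesConst_pos (hna' m)
  have hCn : ∀ o, 0 < ∫ ρ in Ioi (0:ℝ), ρ ^ (nn o) / (1 + ρ ^ a) :=
    fun o => VLawStieltjes.stieltjesConst_pos (hnan o)
  have hD : ∀ j, (s ^ a)⁻¹ - ((u j) ^ a)⁻¹ ≠ 0 := by
    intro j h
    exact hsu j ((pow_left_inj₀ hs.le (hu j).le ha.ne').1 (inv_injective (sub_eq_zero.1 h)))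
  have hli' : ∀ g : Fin k → ℝ, ∑ i, g i • v i = 0 → ∀ i, g i = 0 := Fintype.linearIndependent_iff.1 hli
  -- Step 1: bilinear expansion and the entrywise form
  rw [quadForm_sum_smul]
  have hentry : ∀ i j, v i ⬝ᵥ ((J + (s ^ a)⁻¹ • P + ∑ l, s ^ (b l) • Q l + ∑ m, (s ^ (c m))⁻¹ • R m
        + ∑ p, s ^ a • B p + ∑ r, ((s ^ a) ^ 2)⁻¹ • E r + ∑ o, (s ^ (cn o))⁻¹ • S o) *ᵥ v j)
      = (∑ l, (v i ⬝ᵥ (Q l *ᵥ v j)) * (((s ^ a)⁻¹ - ((u i) ^ a)⁻¹) * ((s ^ a)⁻¹ - ((u j) ^ a)⁻¹)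
          * (∫ ρ in Ioi (0:ℝ), ρ ^ (n l) / (((u i) ^ a)⁻¹ + ρ ^ a)
              * ((((u j) ^ a)⁻¹ + ρ ^ a)⁻¹ * ((s ^ a)⁻¹ + ρ ^ a)⁻¹))
          / ∫ ρ in Ioi (0:ℝ), ρ ^ (n l) / (1 + ρ ^ a)))
        + (∑ m, (v i ⬝ᵥ (R m *ᵥ v j)) * (((s ^ a)⁻¹ - ((u i) ^ a)⁻¹) * ((s ^ a)⁻¹ - ((u j) ^ a)⁻¹)
          * (∫ ρ in Ioi (0:ℝ), ρ ^ (n' m) / ((s ^ a)⁻¹ + ρ ^ a)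
              * ((ρ ^ a * (((u i) ^ a)⁻¹ + ρ ^ a)⁻¹) * (ρ ^ a * (((u j) ^ a)⁻¹ + ρ ^ a)⁻¹)))
          / ∫ ρ in Ioi (0:ℝ), ρ ^ (n' m) / (1 + ρ ^ a)))
        + (∑ p, (v i ⬝ᵥ (B p *ᵥ v j)) * (((s ^ a)⁻¹ - ((u i) ^ a)⁻¹) * ((s ^ a)⁻¹ - ((u j) ^ a)⁻¹)
          * ((u i) ^ a * (u j) ^ a * s ^ a)))
        + (∑ r, (v i ⬝ᵥ (E r *ᵥ v j)) * (((s ^ a)⁻¹ - ((u i) ^ a)⁻¹) * ((s ^ a)⁻¹ - ((u j) ^ a)⁻¹)))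
        + (∑ o, (v i ⬝ᵥ ((-S o) *ᵥ v j)) * (((s ^ a)⁻¹ - ((u i) ^ a)⁻¹) * ((s ^ a)⁻¹ - ((u j) ^ a)⁻¹)
          * (∫ ρ in Ioi (0:ℝ), ρ ^ (nn o) / ((s ^ a)⁻¹ + ρ ^ a)
              * ((ρ ^ a * (((u i) ^ a)⁻¹ + ρ ^ a)⁻¹) * (((u j) ^ a)⁻¹ + ρ ^ a)⁻¹))
          / ∫ ρ in Ioi (0:ℝ), ρ ^ (nn o) / (1 + ρ ^ a)))
        + if i = j then ((s ^ a)⁻¹ - ((u i) ^ a)⁻¹) * (v i ⬝ᵥ (P *ᵥ v i)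
            - ∑ l, ((b l : ℝ) / a) * (u i) ^ (a + b l) * (v i ⬝ᵥ (Q l *ᵥ v i))
            + ∑ m, ((c m : ℝ) / a) * (u i) ^ a * ((u i) ^ (c m))⁻¹ * (v i ⬝ᵥ (R m *ᵥ v i))
            - ∑ p, ((u i) ^ a) ^ 2 * (v i ⬝ᵥ (B p *ᵥ v i))
            + ∑ r, 2 * ((u i) ^ a)⁻¹ * (v i ⬝ᵥ (E r *ᵥ v i))
            + ∑ o, ((cn o : ℝ) / a) * (u i) ^ a * ((u i) ^ (cn o))⁻¹ * (v i ⬝ᵥ (S o *ᵥ v i))) else 0 := by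
    intro i j
    by_cases hij : i = j
    · subst hij
      rw [if_pos rfl]
      exact entry_diag₅ ha hnb hb hnb' hb' hc hnbn hbn hcn J P Q R B E S (hu i) hs (hker i)
    · rw [if_neg hij, add_zero]
      exact entry_offdiag₅ ha hnb hb hnb' hb' hc hnbn hbn hcn hJ hP hQs hRs hBs hEs hSs (hu i) (hu j) hs
        (fun h => hij (hinj h)) (hker i) (hker j)
  simp_rw [hentry]
  rw [rearrange₅ cc (fun i => (s ^ a)⁻¹ - ((u i) ^ a)⁻¹)
    (fun i => ((s ^ a)⁻¹ - ((u i) ^ a)⁻¹) * (v i ⬝ᵥ (P *ᵥ v i)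
      - ∑ l, ((b l : ℝ) / a) * (u i) ^ (a + b l) * (v i ⬝ᵥ (Q l *ᵥ v i))
      + ∑ m, ((c m : ℝ) / a) * (u i) ^ a * ((u i) ^ (c m))⁻¹ * (v i ⬝ᵥ (R m *ᵥ v i))
      - ∑ p, ((u i) ^ a) ^ 2 * (v i ⬝ᵥ (B p *ᵥ v i))
      + ∑ r, 2 * ((u i) ^ a)⁻¹ * (v i ⬝ᵥ (E r *ᵥ v i))
      + ∑ o, ((cn o : ℝ) / a) * (u i) ^ a * ((u i) ^ (cn o))⁻¹ * (v i ⬝ᵥ (S o *ᵥ v i))))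
    (fun l i j => v i ⬝ᵥ (Q l *ᵥ v j))
    (fun l i j => ∫ ρ in Ioi (0:ℝ), ρ ^ (n l) / (((u i) ^ a)⁻¹ + ρ ^ a)
        * ((((u j) ^ a)⁻¹ + ρ ^ a)⁻¹ * ((s ^ a)⁻¹ + ρ ^ a)⁻¹))
    (fun l => ∫ ρ in Ioi (0:ℝ), ρ ^ (n l) / (1 + ρ ^ a))
    (fun m i j => v i ⬝ᵥ (R m *ᵥ v j))
    (fun m i j => ∫ ρ in Ioi (0:ℝ), ρ ^ (n' m) / ((s ^ a)⁻¹ + ρ ^ a)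
        * ((ρ ^ a * (((u i) ^ a)⁻¹ + ρ ^ a)⁻¹) * (ρ ^ a * (((u j) ^ a)⁻¹ + ρ ^ a)⁻¹)))
    (fun m => ∫ ρ in Ioi (0:ℝ), ρ ^ (n' m) / (1 + ρ ^ a))
    (fun p i j => v i ⬝ᵥ (B p *ᵥ v j)) (fun i => (u i) ^ a) (s ^ a)
    (fun r i j => v i ⬝ᵥ (E r *ᵥ v j))
    (fun o i j => v i ⬝ᵥ ((-S o) *ᵥ v j))
    (fun o i j => ∫ ρ in Ioi (0:ℝ), ρ ^ (nn o) / ((s ^ a)⁻¹ + ρ ^ a)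
        * ((ρ ^ a * (((u i) ^ a)⁻¹ + ρ ^ a)⁻¹) * (((u j) ^ a)⁻¹ + ρ ^ a)⁻¹))
    (fun o => ∫ ρ in Ioi (0:ℝ), ρ ^ (nn o) / (1 + ρ ^ a))]
  -- Step 2: the Gram blocks
  set e : Fin k → ℝ := fun i => cc i * ((s ^ a)⁻¹ - ((u i) ^ a)⁻¹) with he_def
  have hblock : ∀ l, ∑ i, ∑ j, cc i * ((s ^ a)⁻¹ - ((u i) ^ a)⁻¹) * (cc j * ((s ^ a)⁻¹ - ((u j) ^ a)⁻¹))
      * (v i ⬝ᵥ (Q l *ᵥ v j))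
      * (∫ ρ in Ioi (0:ℝ), ρ ^ (n l) / (((u i) ^ a)⁻¹ + ρ ^ a) * ((((u j) ^ a)⁻¹ + ρ ^ a)⁻¹ * ((s ^ a)⁻¹ + ρ ^ a)⁻¹))
      = ∫ ρ in Ioi (0:ℝ), ∑ i, ∑ j, e i * e j * (v i ⬝ᵥ (Q l *ᵥ v j))
        * (ρ ^ (n l) / (((u i) ^ a)⁻¹ + ρ ^ a) * ((((u j) ^ a)⁻¹ + ρ ^ a)⁻¹ * ((s ^ a)⁻¹ + ρ ^ a)⁻¹)) :=
    fun l => (integral_quadForm (hna l) (fun i => ((u i) ^ a)⁻¹) hw ht (Q l) v e).symm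
  have hblock' : ∀ m, ∑ i, ∑ j, cc i * ((s ^ a)⁻¹ - ((u i) ^ a)⁻¹) * (cc j * ((s ^ a)⁻¹ - ((u j) ^ a)⁻¹))
      * (v i ⬝ᵥ (R m *ᵥ v j))
      * (∫ ρ in Ioi (0:ℝ), ρ ^ (n' m) / ((s ^ a)⁻¹ + ρ ^ a)
          * ((ρ ^ a * (((u i) ^ a)⁻¹ + ρ ^ a)⁻¹) * (ρ ^ a * (((u j) ^ a)⁻¹ + ρ ^ a)⁻¹)))
      = ∫ ρ in Ioi (0:ℝ), ∑ i, ∑ j, e i * e j * (v i ⬝ᵥ (R m *ᵥ v j))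
        * (ρ ^ (n' m) / ((s ^ a)⁻¹ + ρ ^ a)
          * ((ρ ^ a * (((u i) ^ a)⁻¹ + ρ ^ a)⁻¹) * (ρ ^ a * (((u j) ^ a)⁻¹ + ρ ^ a)⁻¹))) :=
    fun m => (integral_quadForm₂ (hna' m) (fun i => ((u i) ^ a)⁻¹) hw ht (R m) v e).symm
  have hblockS : ∀ o, ∑ i, ∑ j, cc i * ((s ^ a)⁻¹ - ((u i) ^ a)⁻¹) * (cc j * ((s ^ a)⁻¹ - ((u j) ^ a)⁻¹))
      * (v i ⬝ᵥ ((-S o) *ᵥ v j))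
      * (∫ ρ in Ioi (0:ℝ), ρ ^ (nn o) / ((s ^ a)⁻¹ + ρ ^ a)
          * ((ρ ^ a * (((u i) ^ a)⁻¹ + ρ ^ a)⁻¹) * (((u j) ^ a)⁻¹ + ρ ^ a)⁻¹))
      = ∫ ρ in Ioi (0:ℝ), ∑ i, ∑ j, e i * e j * (v i ⬝ᵥ ((-S o) *ᵥ v j))
        * (ρ ^ (nn o) / ((s ^ a)⁻¹ + ρ ^ a)
          * ((ρ ^ a * (((u i) ^ a)⁻¹ + ρ ^ a)⁻¹) * (((u j) ^ a)⁻¹ + ρ ^ a)⁻¹)) :=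
    fun o => (integral_quadForm₃ (hnan o) (fun i => ((u i) ^ a)⁻¹) hw ht (-S o) v e).symm
  have hblockB : ∀ p, ∑ i, ∑ j, cc i * ((s ^ a)⁻¹ - ((u i) ^ a)⁻¹) * (u i) ^ a
        * (cc j * ((s ^ a)⁻¹ - ((u j) ^ a)⁻¹) * (u j) ^ a) * (v i ⬝ᵥ (B p *ᵥ v j))
      = (∑ i, (e i * (u i) ^ a) • v i) ⬝ᵥ (B p *ᵥ ∑ j, (e j * (u j) ^ a) • v j) := fun p => by
    rw [quadForm_sum_smul]
  have hblockE : ∀ r, ∑ i, ∑ j, cc i * ((s ^ a)⁻¹ - ((u i) ^ a)⁻¹)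
        * (cc j * ((s ^ a)⁻¹ - ((u j) ^ a)⁻¹)) * (v i ⬝ᵥ (E r *ᵥ v j))
      = (∑ i, e i • v i) ⬝ᵥ (E r *ᵥ ∑ j, e j • v j) := fun r => by
    rw [quadForm_sum_smul]
  have hnonneg : ∀ l (ρ : ℝ), 0 < ρ → 0 ≤ ∑ i, ∑ j, e i * e j * (v i ⬝ᵥ (Q l *ᵥ v j))
      * (ρ ^ (n l) / (((u i) ^ a)⁻¹ + ρ ^ a) * ((((u j) ^ a)⁻¹ + ρ ^ a)⁻¹ * ((s ^ a)⁻¹ + ρ ^ a)⁻¹)) := by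
    intro l ρ hρ
    rw [quadForm_y]
    refine mul_nonneg (mul_nonneg (pow_nonneg hρ.le _) (VLawStieltjes.inv_den_le ht hρ.le).1) ?_
    have h := (hQ l).dotProduct_mulVec_nonneg (∑ j, (e j * (((u j) ^ a)⁻¹ + ρ ^ a)⁻¹) • v j)
    rwa [star_trivial] at h
  have hnonneg' : ∀ m (ρ : ℝ), 0 < ρ → 0 ≤ ∑ i, ∑ j, e i * e j * (v i ⬝ᵥ (R m *ᵥ v j))
      * (ρ ^ (n' m) / ((s ^ a)⁻¹ + ρ ^ a)
        * ((ρ ^ a * (((u i) ^ a)⁻¹ + ρ ^ a)⁻¹) * (ρ ^ a * (((u j) ^ a)⁻¹ + ρ ^ a)⁻¹))) := by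
    intro m ρ hρ
    rw [quadForm_y₂]
    refine mul_nonneg (div_nonneg (pow_nonneg hρ.le _) (VLawStieltjes.den_pos ht a hρ.le).le) ?_
    have h := (hR m).dotProduct_mulVec_nonneg (∑ j, (e j * (ρ ^ a * (((u j) ^ a)⁻¹ + ρ ^ a)⁻¹)) • v j)
    rwa [star_trivial] at h
  have hnonnegS : ∀ o (ρ : ℝ), 0 < ρ → 0 ≤ ∑ i, ∑ j, e i * e j * (v i ⬝ᵥ ((-S o) *ᵥ v j))
      * (ρ ^ (nn o) / ((s ^ a)⁻¹ + ρ ^ a)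
        * ((ρ ^ a * (((u i) ^ a)⁻¹ + ρ ^ a)⁻¹) * (((u j) ^ a)⁻¹ + ρ ^ a)⁻¹)) := by
    intro o ρ hρ
    rw [quadForm_y₃]
    refine mul_nonneg (mul_nonneg (div_nonneg (pow_nonneg hρ.le _) (VLawStieltjes.den_pos ht a hρ.le).le)
      (pow_nonneg hρ.le a)) ?_
    have h := (hS o).dotProduct_mulVec_nonneg (∑ j, (e j * (((u j) ^ a)⁻¹ + ρ ^ a)⁻¹) • v j)
    rwa [star_trivial] at h
  -- Step 3: the slack terms are nonnegative (STAR)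
  have hslack_eq : ∀ i, v i ⬝ᵥ (P *ᵥ v i) - ∑ l, ((b l : ℝ) / a) * (u i) ^ (a + b l) * (v i ⬝ᵥ (Q l *ᵥ v i))
        + ∑ m, ((c m : ℝ) / a) * (u i) ^ a * ((u i) ^ (c m))⁻¹ * (v i ⬝ᵥ (R m *ᵥ v i))
        - ∑ p, ((u i) ^ a) ^ 2 * (v i ⬝ᵥ (B p *ᵥ v i))
        + ∑ r, 2 * ((u i) ^ a)⁻¹ * (v i ⬝ᵥ (E r *ᵥ v i))
        + ∑ o, ((cn o : ℝ) / a) * (u i) ^ a * ((u i) ^ (cn o))⁻¹ * (v i ⬝ᵥ (S o *ᵥ v i))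
      = -((u i) ^ a / a) * (-((a : ℝ) * ((u i) ^ a)⁻¹ * (v i ⬝ᵥ (P *ᵥ v i)))
          + ∑ l, (b l : ℝ) * (u i) ^ (b l) * (v i ⬝ᵥ (Q l *ᵥ v i))
          - ∑ m, (c m : ℝ) * ((u i) ^ (c m))⁻¹ * (v i ⬝ᵥ (R m *ᵥ v i))
          + ∑ p, (a : ℝ) * (u i) ^ a * (v i ⬝ᵥ (B p *ᵥ v i))
          - ∑ r, (2 * a : ℝ) * (((u i) ^ a) ^ 2)⁻¹ * (v i ⬝ᵥ (E r *ᵥ v i))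
          - ∑ o, (cn o : ℝ) * ((u i) ^ (cn o))⁻¹ * (v i ⬝ᵥ (S o *ᵥ v i))) := by
    intro i
    have ha0 : (a : ℝ) ≠ 0 := by exact_mod_cast ha.ne'
    have hu0 : (u i) ^ a ≠ 0 := (pow_pos (hu i) a).ne'
    have eP : -((u i) ^ a / a) * (-((a : ℝ) * ((u i) ^ a)⁻¹ * (v i ⬝ᵥ (P *ᵥ v i)))) = v i ⬝ᵥ (P *ᵥ v i) := by
      field_simp
    have eQ : ∀ l, -((u i) ^ a / a) * ((b l : ℝ) * (u i) ^ (b l) * (v i ⬝ᵥ (Q l *ᵥ v i)))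
        = -(((b l : ℝ) / a) * (u i) ^ (a + b l) * (v i ⬝ᵥ (Q l *ᵥ v i))) := fun l => by
      rw [pow_add]; field_simp
    have eR : ∀ m, -((u i) ^ a / a) * ((c m : ℝ) * ((u i) ^ (c m))⁻¹ * (v i ⬝ᵥ (R m *ᵥ v i)))
        = -(((c m : ℝ) / a) * (u i) ^ a * ((u i) ^ (c m))⁻¹ * (v i ⬝ᵥ (R m *ᵥ v i))) := fun m => by
      field_simp
    have eB : ∀ p, -((u i) ^ a / a) * ((a : ℝ) * (u i) ^ a * (v i ⬝ᵥ (B p *ᵥ v i)))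
        = -(((u i) ^ a) ^ 2 * (v i ⬝ᵥ (B p *ᵥ v i))) := fun p => by
      field_simp
    have eE : ∀ r, -((u i) ^ a / a) * ((2 * a : ℝ) * (((u i) ^ a) ^ 2)⁻¹ * (v i ⬝ᵥ (E r *ᵥ v i)))
        = -(2 * ((u i) ^ a)⁻¹ * (v i ⬝ᵥ (E r *ᵥ v i))) := fun r => by
      field_simp
    have eS : ∀ o, -((u i) ^ a / a) * ((cn o : ℝ) * ((u i) ^ (cn o))⁻¹ * (v i ⬝ᵥ (S o *ᵥ v i)))
        = -(((cn o : ℝ) / a) * (u i) ^ a * ((u i) ^ (cn o))⁻¹ * (v i ⬝ᵥ (S o *ᵥ v i))) := fun o => by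
      field_simp
    rw [mul_sub, mul_sub, mul_add, mul_sub, mul_add, Finset.mul_sum, Finset.mul_sum, Finset.mul_sum,
      Finset.mul_sum, Finset.mul_sum]
    simp_rw [eP, eQ, eR, eB, eE, eS, Finset.sum_neg_distrib]
    ring
  have hslack : ∀ i, 0 ≤ ((s ^ a)⁻¹ - ((u i) ^ a)⁻¹) * (v i ⬝ᵥ (P *ᵥ v i)
      - ∑ l, ((b l : ℝ) / a) * (u i) ^ (a + b l) * (v i ⬝ᵥ (Q l *ᵥ v i))
      + ∑ m, ((c m : ℝ) / a) * (u i) ^ a * ((u i) ^ (c m))⁻¹ * (v i ⬝ᵥ (R m *ᵥ v i))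
      - ∑ p, ((u i) ^ a) ^ 2 * (v i ⬝ᵥ (B p *ᵥ v i))
      + ∑ r, 2 * ((u i) ^ a)⁻¹ * (v i ⬝ᵥ (E r *ᵥ v i))
      + ∑ o, ((cn o : ℝ) / a) * (u i) ^ a * ((u i) ^ (cn o))⁻¹ * (v i ⬝ᵥ (S o *ᵥ v i))) := by
    intro i
    rw [hslack_eq, ← mul_assoc]
    have h := weight_sign (a := a) hs (hu i) (hstar i)
    have hpos : 0 ≤ (u i) ^ a / a := div_nonneg (pow_nonneg (hu i).le a) (Nat.cast_nonneg a)
    have hcoef : ((s ^ a)⁻¹ - ((u i) ^ a)⁻¹) * -((u i) ^ a / a) = ((u i) ^ a / a) * (((u i) ^ a)⁻¹ - (s ^ a)⁻¹) := by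
      ring
    rw [hcoef, mul_assoc]
    exact mul_nonneg hpos h
  -- Step 4: nonnegativity of the six parts
  have hAterm : ∀ l, 0 ≤ (∫ ρ in Ioi (0:ℝ), ρ ^ (n l) / (1 + ρ ^ a))⁻¹ *
      ∑ i, ∑ j, cc i * ((s ^ a)⁻¹ - ((u i) ^ a)⁻¹) * (cc j * ((s ^ a)⁻¹ - ((u j) ^ a)⁻¹))
        * (v i ⬝ᵥ (Q l *ᵥ v j))
        * (∫ ρ in Ioi (0:ℝ), ρ ^ (n l) / (((u i) ^ a)⁻¹ + ρ ^ a)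
            * ((((u j) ^ a)⁻¹ + ρ ^ a)⁻¹ * ((s ^ a)⁻¹ + ρ ^ a)⁻¹)) := fun l => by
    rw [hblock l]
    exact mul_nonneg (inv_nonneg.2 (hC l).le) (setIntegral_nonneg measurableSet_Ioi fun ρ hρ => hnonneg l ρ hρ)
  have hAterm' : ∀ m, 0 ≤ (∫ ρ in Ioi (0:ℝ), ρ ^ (n' m) / (1 + ρ ^ a))⁻¹ *
      ∑ i, ∑ j, cc i * ((s ^ a)⁻¹ - ((u i) ^ a)⁻¹) * (cc j * ((s ^ a)⁻¹ - ((u j) ^ a)⁻¹))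
        * (v i ⬝ᵥ (R m *ᵥ v j))
        * (∫ ρ in Ioi (0:ℝ), ρ ^ (n' m) / ((s ^ a)⁻¹ + ρ ^ a)
            * ((ρ ^ a * (((u i) ^ a)⁻¹ + ρ ^ a)⁻¹) * (ρ ^ a * (((u j) ^ a)⁻¹ + ρ ^ a)⁻¹))) := fun m => by
    rw [hblock' m]
    exact mul_nonneg (inv_nonneg.2 (hC' m).le) (setIntegral_nonneg measurableSet_Ioi fun ρ hρ => hnonneg' m ρ hρ)
  have hBterm : ∀ p, 0 ≤ s ^ a * ∑ i, ∑ j, cc i * ((s ^ a)⁻¹ - ((u i) ^ a)⁻¹) * (u i) ^ a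
        * (cc j * ((s ^ a)⁻¹ - ((u j) ^ a)⁻¹) * (u j) ^ a) * (v i ⬝ᵥ (B p *ᵥ v j)) := fun p => by
    rw [hblockB p]
    have h := (hB p).dotProduct_mulVec_nonneg (∑ j, (e j * (u j) ^ a) • v j)
    rw [star_trivial] at h
    exact mul_nonneg (pow_pos hs a).le h
  have hEterm : ∀ r, 0 ≤ ∑ i, ∑ j, cc i * ((s ^ a)⁻¹ - ((u i) ^ a)⁻¹)
        * (cc j * ((s ^ a)⁻¹ - ((u j) ^ a)⁻¹)) * (v i ⬝ᵥ (E r *ᵥ v j)) := fun r => by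
    rw [hblockE r]
    have h := (hE r).dotProduct_mulVec_nonneg (∑ j, e j • v j)
    rwa [star_trivial] at h
  have hSterm : ∀ o, 0 ≤ (∫ ρ in Ioi (0:ℝ), ρ ^ (nn o) / (1 + ρ ^ a))⁻¹ *
      ∑ i, ∑ j, cc i * ((s ^ a)⁻¹ - ((u i) ^ a)⁻¹) * (cc j * ((s ^ a)⁻¹ - ((u j) ^ a)⁻¹))
        * (v i ⬝ᵥ ((-S o) *ᵥ v j))
        * (∫ ρ in Ioi (0:ℝ), ρ ^ (nn o) / ((s ^ a)⁻¹ + ρ ^ a)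
            * ((ρ ^ a * (((u i) ^ a)⁻¹ + ρ ^ a)⁻¹) * (((u j) ^ a)⁻¹ + ρ ^ a)⁻¹)) := fun o => by
    rw [hblockS o]
    exact mul_nonneg (inv_nonneg.2 (hCn o).le) (setIntegral_nonneg measurableSet_Ioi fun ρ hρ => hnonnegS o ρ hρ)
  have hA := Finset.sum_nonneg fun l (_ : l ∈ Finset.univ) => hAterm l
  have hA' := Finset.sum_nonneg fun m (_ : m ∈ Finset.univ) => hAterm' m
  have hAB := Finset.sum_nonneg fun p (_ : p ∈ Finset.univ) => hBterm p
  have hAE := Finset.sum_nonneg fun r (_ : r ∈ Finset.univ) => hEterm r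
  have hAS := Finset.sum_nonneg fun o (_ : o ∈ Finset.univ) => hSterm o
  have hBslack := Finset.sum_nonneg fun i (_ : i ∈ Finset.univ) => mul_nonneg (sq_nonneg (cc i)) (hslack i)
  refine lt_of_le_of_ne (add_nonneg (add_nonneg (add_nonneg (add_nonneg (add_nonneg hA hA') hAB) hAE) hAS)
    hBslack) fun hzero => ?_
  have hA0 := le_antisymm (by linarith) hA
  have hA0' := le_antisymm (by linarith) hA'
  have hAB0 := le_antisymm (by linarith) hAB
  have hAE0 := le_antisymm (by linarith) hAE
  have hAS0 := le_antisymm (by linarith) hAS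
  obtain ⟨i₀, hi₀⟩ := Function.ne_iff.1 hcc
  have he₀ : e i₀ ≠ 0 := mul_ne_zero hi₀ (hD i₀)
  have hw1 : ∀ i, (((u i) ^ a)⁻¹ + 1 ^ a)⁻¹ ≠ 0 := fun i =>
    inv_ne_zero (VLawStieltjes.den_pos (hw i) a zero_le_one).ne'
  -- strictness from the definite companion letter and linear independence
  rcases hPD with ⟨l, hl⟩ | ⟨m, hm⟩ | ⟨p, hp⟩ | ⟨r, hr⟩ | ⟨o, ho⟩
  · have hl0 := (Finset.sum_eq_zero_iff_of_nonneg fun l _ => hAterm l).1 hA0 l (Finset.mem_univ l)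
    rw [hblock l, mul_eq_zero] at hl0
    have hvan := eq_zero_of_integral_eq_zero
      (continuousOn_kernelSum (n l) a hw ht (fun i j => v i ⬝ᵥ (Q l *ᵥ v j)) e) (hnonneg l)
      (integrable_finsetSum _ fun i _ => integrable_finsetSum _ fun j _ =>
        integrableOn_kernel_term (hna l) (hw i) (hw j) ht _) (hl0.resolve_left (inv_ne_zero (hC l).ne'))
    have h0 := hvan 1 one_pos
    rw [quadForm_y, mul_eq_zero] at h0
    have h1 := h0.resolve_left (mul_ne_zero (pow_pos one_pos _).ne'
      (inv_ne_zero (VLawStieltjes.den_pos ht a zero_le_one).ne'))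
    have hy : ∑ i, (e i * (((u i) ^ a)⁻¹ + 1 ^ a)⁻¹) • v i = 0 := by
      by_contra hy
      have hpos := hl.dotProduct_mulVec_pos hy
      rw [star_trivial, h1] at hpos
      exact lt_irrefl 0 hpos
    exact (mul_ne_zero he₀ (hw1 i₀)) (hli' _ hy i₀)
  · have hl0 := (Finset.sum_eq_zero_iff_of_nonneg fun m _ => hAterm' m).1 hA0' m (Finset.mem_univ m)
    rw [hblock' m, mul_eq_zero] at hl0
    have hvan := eq_zero_of_integral_eq_zero
      (continuousOn_kernelSum₂ (n' m) a hw ht (fun i j => v i ⬝ᵥ (R m *ᵥ v j)) e) (hnonneg' m)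
      (integrable_finsetSum _ fun i _ => integrable_finsetSum _ fun j _ =>
        integrableOn_kernel_term₂ (hna' m) (hw i) (hw j) ht _) (hl0.resolve_left (inv_ne_zero (hC' m).ne'))
    have h0 := hvan 1 one_pos
    rw [quadForm_y₂, mul_eq_zero] at h0
    have h1 := h0.resolve_left (div_pos (pow_pos one_pos _) (VLawStieltjes.den_pos ht a zero_le_one)).ne'
    have hy : ∑ i, (e i * ((1:ℝ) ^ a * (((u i) ^ a)⁻¹ + 1 ^ a)⁻¹)) • v i = 0 := by
      by_contra hy
      have hpos := hm.dotProduct_mulVec_pos hy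
      rw [star_trivial, h1] at hpos
      exact lt_irrefl 0 hpos
    have h2 := hli' _ hy i₀
    rw [one_pow, one_mul] at h2
    exact (mul_ne_zero he₀ (inv_ne_zero (add_pos (hw i₀) one_pos).ne')) h2
  · have hp0 := (Finset.sum_eq_zero_iff_of_nonneg fun p _ => hBterm p).1 hAB0 p (Finset.mem_univ p)
    rw [hblockB p, mul_eq_zero] at hp0
    have h1 := hp0.resolve_left (pow_pos hs a).ne'
    have hy : ∑ i, (e i * (u i) ^ a) • v i = 0 := by
      by_contra hy
      have hpos := hp.dotProduct_mulVec_pos hy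
      rw [star_trivial, h1] at hpos
      exact lt_irrefl 0 hpos
    exact (mul_ne_zero he₀ (pow_pos (hu i₀) a).ne') (hli' _ hy i₀)
  · have hr0 := (Finset.sum_eq_zero_iff_of_nonneg fun r _ => hEterm r).1 hAE0 r (Finset.mem_univ r)
    rw [hblockE r] at hr0
    have hy : ∑ i, e i • v i = 0 := by
      by_contra hy
      have hpos := hr.dotProduct_mulVec_pos hy
      rw [star_trivial, hr0] at hpos
      exact lt_irrefl 0 hpos
    exact he₀ (hli' _ hy i₀)
  · have hl0 := (Finset.sum_eq_zero_iff_of_nonneg fun o _ => hSterm o).1 hAS0 o (Finset.mem_univ o)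
    rw [hblockS o, mul_eq_zero] at hl0
    have hvan := eq_zero_of_integral_eq_zero
      (continuousOn_kernelSum₃ (nn o) a hw ht (fun i j => v i ⬝ᵥ ((-S o) *ᵥ v j)) e) (hnonnegS o)
      (integrable_finsetSum _ fun i _ => integrable_finsetSum _ fun j _ =>
        integrableOn_kernel_term₃ (hnan o) (hw i) (hw j) ht _) (hl0.resolve_left (inv_ne_zero (hCn o).ne'))
    have h0 := hvan 1 one_pos
    rw [quadForm_y₃, mul_eq_zero] at h0
    have h1 := h0.resolve_left (mul_ne_zero
      (div_pos (pow_pos one_pos _) (VLawStieltjes.den_pos ht a zero_le_one)).ne' (pow_pos one_pos a).ne')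
    have hy : ∑ i, (e i * (((u i) ^ a)⁻¹ + 1 ^ a)⁻¹) • v i = 0 := by
      by_contra hy
      have hpos := ho.dotProduct_mulVec_pos hy
      rw [star_trivial, h1] at hpos
      exact lt_irrefl 0 hpos
    exact (mul_ne_zero he₀ (hw1 i₀)) (hli' _ hy i₀)

end VLawCoreSigned

end Summit.ValiantsHypothesis.ValiantsHypothesis.Theorems.LacunarySymmetroidMatrixDescartes
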